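import Literature.Algebra.Polynomial.CasasAlvero.CharPCounterexample
import Literature.Algebra.Polynomial.CasasAlvero.Descent
import Literature.Algebra.Polynomial.CasasAlvero.Induction
import HarnessLib

/-!
# Casas-Alvero in degrees 3 and 4 over fields of arbitrary characteristic

Assembling `Induction.lean` (degree 3 when `6 ≠ 0`), `Degree4.lean` (degree 4 when `210 ≠ 0`), `Descent.lean`
(degrees `p^k` over every field of characteristic `p`) and `CharPCounterexample.lean` (failure in degree `p + 1`):
* degree 3, complete answer: `HoldsInDegree K 3 ↔ (2 : K) ≠ 0` — characteristic 3 is covered by `3 = 3^1`,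
  characteristic 2 fails by `3 = 2 + 1` (as stated in Graf von Bothmer et al. 2007, §3: "for d = 3 the Conjecture is
  true for a field of any characteristic, except 2");
* degree 4: holds whenever `char K ∉ {3, 5, 7}` (characteristic 2 is covered by `4 = 2^2`), fails in characteristic 3 (`4 = 3 + 1`);
  characteristics 5 and 7 are not decided by these files.
[cite: GrafVonBothmerEtAl2007, Sec. 3]
-/

noncomputable section

open Polynomial

namespace Literature.Algebra.Polynomial.CasasAlvero

variable (K : Type*) [Field K]

/-- Degree 3 over a field: CA₃ holds iff the characteristic is not 2. [cite: GrafVonBothmerEtAl2007, Sec. 3] -/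
theorem holdsInDegree_three_iff : HoldsInDegree K 3 ↔ (2 : K) ≠ 0 := by
  constructor
  · intro h h2
    haveI : CharP K 2 := (CharP.charP_iff_prime_eq_zero Nat.prime_two).mpr h2
    exact not_holdsInDegree_prime_succ K 2 h
  · intro h2
    by_cases h3 : (3 : K) = 0
    · haveI : CharP K 3 := (CharP.charP_iff_prime_eq_zero Nat.prime_three).mpr h3
      simpa using holdsInDegree_prime_pow_field K 3 1
    · refine holdsInDegree_three ?_
      have : (6 : K) = 2 * 3 := by norm_num
      rw [this]; exact mul_ne_zero h2 h3

/-- Degree 4 holds in characteristic 2 (`4 = 2^2`). [cite: GrafVonBothmerEtAl2007, Prop. 5] -/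
theorem holdsInDegree_four_of_char_two [CharP K 2] : HoldsInDegree K 4 := by
  simpa using holdsInDegree_prime_pow_field K 2 2

/-- Degree 4 fails in characteristic 3 (`4 = 3 + 1`). [cite: GrafVonBothmerEtAl2007, Prop. 7] -/
theorem not_holdsInDegree_four_of_char_three [CharP K 3] : ¬ HoldsInDegree K 4 :=
  not_holdsInDegree_prime_succ K 3

/-- Degree 4 holds over every field whose characteristic is not 3, 5 or 7. [cite: GrafVonBothmerEtAl2007, Sec. 3] -/
theorem holdsInDegree_four_of_ne (h3 : (3 : K) ≠ 0) (h5 : (5 : K) ≠ 0) (h7 : (7 : K) ≠ 0) : HoldsInDegree K 4 := by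
  by_cases h2 : (2 : K) = 0
  · haveI : CharP K 2 := (CharP.charP_iff_prime_eq_zero Nat.prime_two).mpr h2
    exact holdsInDegree_four_of_char_two K
  · refine holdsInDegree_four ?_
    have : (210 : K) = 2 * 3 * 5 * 7 := by norm_num
    rw [this]; exact mul_ne_zero (mul_ne_zero (mul_ne_zero h2 h3) h5) h7

end Literature.Algebra.Polynomial.CasasAlvero
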